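import Literature.Probability.RandomPlanarGeometry.SAWAdsorptionLowTemperature
import HarnessLib

/-!
# Low-temperature law of the adsorbing half-plane SAW on `ℤ²`: the zero-sum-window framework

Topic `Literature/Probability/RandomPlanarGeometry` (continues `SAWAdsorptionLowTemperature.lean` — the potential method
on no-reversal words — and `SAWAdsorptionLowTemperatureExact.lean` — its memory-10 «no unit square» variant).

The hierarchy of relaxations `R_K`: step words with non-negative heights, weight `a` per wall vertex, and NO suffix window
of even length `2, 4, …, 2K` with zero vector sum (every such window is a closed sub-walk, impossible for a self-avoiding
walk; `K = 1` is «no reversal», `K = 2` adds «no unit square», `K = 3` «no 2×1 rectangle»). Numerically the growth rate of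
`R_K` reproduces the low-temperature expansion `e^{κ(a)} = a + 1/a + 1/a² − 1/a³ + …` to order `a^{-(K-1)}`. This file is
the INVARIANT-FREE framework for all `K` at once: a configuration is (height, the last `m` letters, most recent first);
the bridge `LowTempWin.adm_of_saw` (a zero-sum window of length `2j` means `traj i = traj (i + 2j)`) and the potential
bound `LowTempWin.adsZ_le_of_potential` (any `Λ`-excessive potential `u ≥ δ > 0` on windows that are themselves free of
zero-sum even prefixes gives `Z⁺_n(a) ≤ Λⁿ u(0, [])/δ`). Excessive potentials for `K ≥ 3` are meant to be supplied by a
computational certificate (`SAWAdsorptionLowTemperatureExact3.lean`). Pure standard axioms.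
[cite: BeatonGuttmannJensen2012Adsorption, §1 (p. 2)] (objects), first-order law as reported by
[cite: BeatonBousquetMelouDeGierDuminilCopinGuttmann2014, §3 (arXiv v5 pp. 9–10)]. (Lane «pcv-sawmu», a-p3 g10.)
-/

noncomputable section

open Finset Filter Topology Literature.Probability.LatticeModels
open scoped BigOperators

namespace Literature.Probability.RandomPlanarGeometry.SAW.Zd

namespace LowTempWin

open LowTemp

/-! ### Windows and the one-step rule -/

/-- Vector sum of a list of letters. [cite: BeatonGuttmannJensen2012Adsorption, §1 (p. 2)] -/
def wsum (w : List Step) : Site 2 := (w.map Step.vec).sum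

/-- A window (most recent letter first) is BAD when one of its even-length prefixes has zero vector sum — the last `2j`
letters read would form a closed sub-walk. [cite: BeatonGuttmannJensen2012Adsorption, §1 (p. 2)] -/
def Bad (w : List Step) : Prop := ∃ j ∈ Finset.range (w.length / 2 + 1), 0 < j ∧ wsum (w.take (2 * j)) = 0

/-- `Bad` is decidable. [folklore] -/
instance (w : List Step) : Decidable (Bad w) := by
  unfold Bad; infer_instance

/-- The rule of the relaxation with memory `m`: no step into the wall, and the new window of length `≤ m+1` is not bad.
[cite: BeatonGuttmannJensen2012Adsorption, §1 (p. 2)] -/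
def Allowed (m : ℕ) (h : ℤ) (w : List Step) (s : Step) : Prop := (s = 2 → 1 ≤ h) ∧ ¬ Bad ((s :: w).take (m + 1))

/-- `Allowed` is decidable. [folklore] -/
instance (m : ℕ) (h : ℤ) (w : List Step) (s : Step) : Decidable (Allowed m h w s) := by
  unfold Allowed; infer_instance

/-- Window update. [cite: BeatonGuttmannJensen2012Adsorption, §1 (p. 2)] -/
def push (m : ℕ) (w : List Step) (s : Step) : List Step := (s :: w).take m

/-- Admissible words from `(h, w)`. [cite: BeatonGuttmannJensen2012Adsorption, §1 (p. 2)] -/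
def Adm (m : ℕ) : ℤ → List Step → List Step → Prop
  | _, _, [] => True
  | h, w, s :: v => Allowed m h w s ∧ Adm m (h + s.dx) (push m w s) v

/-- `Adm` is decidable. [folklore] -/
instance decAdm (m : ℕ) : ∀ (h : ℤ) (w : List Step) (v : List Step), Decidable (Adm m h w v)
  | _, _, [] => isTrue trivial
  | h, w, s :: v =>
    haveI := decAdm m (h + s.dx) (push m w s) v
    inferInstanceAs (Decidable (Allowed m h w s ∧ Adm m (h + s.dx) (push m w s) v))

/-- Potential-weighted weight of a word. [cite: BeatonGuttmannJensen2012Adsorption, §1 (p. 2)] -/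
def val (m : ℕ) (u : ℤ → List Step → ℝ) (a : ℝ) : ℤ → List Step → List Step → ℝ
  | h, w, [] => u h w
  | h, w, s :: v => wt a (h + s.dx) * val m u a (h + s.dx) (push m w s) v

/-- `val` on admissible words, zero otherwise. [cite: BeatonGuttmannJensen2012Adsorption, §1 (p. 2)] -/
def F (m : ℕ) (u : ℤ → List Step → ℝ) (a : ℝ) (h : ℤ) (w : List Step) (v : List Step) : ℝ :=
  if Adm m h w v then val m u a h w v else 0

/-- One-step potential sum. [cite: BeatonGuttmannJensen2012Adsorption, §1 (p. 2)] -/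
def locSum (m : ℕ) (u : ℤ → List Step → ℝ) (a : ℝ) (h : ℤ) (w : List Step) : ℝ :=
  ∑ s : Step, if Allowed m h w s then wt a (h + s.dx) * u (h + s.dx) (push m w s) else 0

/-! ### The invariant: windows free of zero-sum even prefixes, of length `≤ m` -/

/-- Reachable windows: length `≤ m` and HEREDITARILY not bad — no suffix `w.drop k` is bad, i.e. no even-length
factor of the window has zero vector sum (every letter of a reachable window passed the `Allowed` test when it was
read). [cite: BeatonGuttmannJensen2012Adsorption, §1 (p. 2)] -/
def Good (m : ℕ) (w : List Step) : Prop := w.length ≤ m ∧ ∀ k, ¬ Bad (w.drop k)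

/-- `Good` is decidable (the quantifier is bounded by the length). [folklore] -/
instance (m : ℕ) (w : List Step) : Decidable (Good m w) :=
  decidable_of_iff (w.length ≤ m ∧ ∀ k < w.length + 1, ¬ Bad (w.drop k)) (by
    refine and_congr_right fun _ => ⟨fun h k => ?_, fun h k _ => h k⟩
    by_cases hk : k < w.length + 1
    · exact h k hk
    · have h0 := h w.length (Nat.lt_succ_self _)
      rw [List.drop_length] at h0
      rwa [List.drop_of_length_le (by omega)])

/-- The empty window is not bad. [folklore] -/
private theorem not_bad_nil : ¬ Bad [] := by
  rintro ⟨j, hj, hj0, -⟩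
  simp at hj
  omega

/-- A prefix of a window that is not bad is not bad. [folklore] -/
private theorem not_bad_take {w : List Step} (hw : ¬ Bad w) (k : ℕ) : ¬ Bad (w.take k) := by
  intro hb
  apply hw
  obtain ⟨j, hj, hj0, hs⟩ := hb
  simp only [Finset.mem_range] at hj
  have hlen : 2 * j ≤ (w.take k).length := by omega
  rw [List.length_take] at hlen
  have hk : 2 * j ≤ k := le_trans hlen (min_le_left _ _)
  have hwl : 2 * j ≤ w.length := le_trans hlen (min_le_right _ _)
  refine ⟨j, ?_, hj0, ?_⟩
  · simp only [Finset.mem_range]; omega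
  · rwa [List.take_take, min_eq_left hk] at hs

/-- `Good` is preserved along allowed letters. [cite: BeatonGuttmannJensen2012Adsorption, §1 (p. 2)] -/
theorem good_push {m : ℕ} {h : ℤ} {w : List Step} {s : Step} (hg : Good m w) (ha : Allowed m h w s) :
    Good m (push m w s) := by
  refine ⟨by simp [push], fun k => ?_⟩
  cases k with
  | zero =>
    have := not_bad_take ha.2 m
    rwa [List.take_take, min_eq_left (Nat.le_succ m)] at this
  | succ j =>
    cases m with
    | zero => simpa [push] using not_bad_nil
    | succ m' =>
      simp only [push, List.take_succ_cons, List.drop_succ_cons, List.drop_take]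
      exact not_bad_take (hg.2 j) _

/-! ### The potential bound -/

/-- `wt ≥ 0`. [folklore] -/
private theorem wt_nonneg' {a : ℝ} (ha : 0 ≤ a) (h : ℤ) : 0 ≤ wt a h := by
  unfold wt; split_ifs
  · exact ha
  · exact zero_le_one

/-- `val ≥ 0`. [folklore] -/
private theorem val_nonneg {m : ℕ} {u : ℤ → List Step → ℝ} (hu : ∀ h w, 0 ≤ u h w) {a : ℝ} (ha : 0 ≤ a) :
    ∀ (v : List Step) (h : ℤ) (w : List Step), 0 ≤ val m u a h w v
  | [], h, w => hu h w
  | _ :: v, _, _ => mul_nonneg (wt_nonneg' ha _) (val_nonneg hu ha v _ _)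

/-- `F ≥ 0`. [folklore] -/
private theorem F_nonneg {m : ℕ} {u : ℤ → List Step → ℝ} (hu : ∀ h w, 0 ≤ u h w) {a : ℝ} (ha : 0 ≤ a)
    (h : ℤ) (w v : List Step) : 0 ≤ F m u a h w v := by
  unfold F; split_ifs
  · exact val_nonneg hu ha v h w
  · exact le_rfl

/-- First-letter recursion for `F`. [folklore] -/
private theorem F_cons (m : ℕ) (u : ℤ → List Step → ℝ) (a : ℝ) (h : ℤ) (w : List Step) (s : Step) (v : List Step) :
    F m u a h w (s :: v) = if Allowed m h w s then wt a (h + s.dx) * F m u a (h + s.dx) (push m w s) v else 0 := by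
  unfold F
  simp only [Adm, val]
  by_cases h1 : Allowed m h w s <;> by_cases h2 : Adm m (h + s.dx) (push m w s) v <;> simp [h1, h2]

/-- Words of length `n + 1` are `s :: v`. [folklore] -/
private theorem words_succ_eq (n : ℕ) :
    words (n + 1) = ((Finset.univ : Finset Step) ×ˢ words n).image fun p => p.1 :: p.2 := by
  ext w
  simp only [mem_words, Finset.mem_image, Finset.mem_product, Finset.mem_univ, true_and]
  constructor
  · intro h
    cases w with
    | nil => simp at h
    | cons st w => exact ⟨(st, w), by simpa using h, rfl⟩
  · rintro ⟨⟨st, w'⟩, hw', rfl⟩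
    simpa using hw'

/-- **The potential bound with the window invariant**: if `u ≥ 0` is `Λ`-excessive at every configuration `(h, w)` with
`h ≥ 0` and `Good m w`, then the potential-weighted sum over admissible words of length `n` from such a configuration is
at most `Λⁿ u(h, w)`. [cite: BeatonGuttmannJensen2012Adsorption, §1 (p. 2)] -/
theorem sum_words_le {m : ℕ} {u : ℤ → List Step → ℝ} {a Λ : ℝ} (ha : 0 ≤ a) (hΛ : 0 ≤ Λ)
    (hloc : ∀ h w, 0 ≤ h → Good m w → locSum m u a h w ≤ Λ * u h w) :
    ∀ (n : ℕ) (h : ℤ) (w : List Step), 0 ≤ h → Good m w → ∑ v ∈ words n, F m u a h w v ≤ Λ ^ n * u h w := by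
  classical
  intro n
  induction n with
  | zero =>
    intro h w _ _
    have h0 : words 0 = {[]} := by
      ext v; simp only [mem_words, Finset.mem_singleton, List.length_eq_zero_iff]
    simp [h0, F, Adm, val]
  | succ n ih =>
    intro h w hh hg
    rw [words_succ_eq, Finset.sum_image, Finset.sum_product]
    · calc ∑ s : Step, ∑ v ∈ words n, F m u a h w (s :: v)
            = ∑ s : Step, (if Allowed m h w s then wt a (h + s.dx) else 0) *
                ∑ v ∈ words n, F m u a (h + s.dx) (push m w s) v := by
              refine Finset.sum_congr rfl fun s _ => ?_
              rw [Finset.mul_sum]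
              refine Finset.sum_congr rfl fun v _ => ?_
              rw [F_cons]
              split_ifs <;> simp
        _ ≤ ∑ s : Step, (if Allowed m h w s then wt a (h + s.dx) else 0) *
                (Λ ^ n * u (h + s.dx) (push m w s)) := by
              refine Finset.sum_le_sum fun s _ => ?_
              by_cases hs : Allowed m h w s
              · rw [if_pos hs]
                refine mul_le_mul_of_nonneg_left (ih _ _ ?_ (good_push hg hs)) (wt_nonneg' ha _)
                rcases hs with ⟨hs2, -⟩
                fin_cases s <;> simp [Step.dx] at hs2 ⊢ <;> omega
              · rw [if_neg hs, zero_mul, zero_mul]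
        _ = Λ ^ n * locSum m u a h w := by
              rw [locSum, Finset.mul_sum]
              refine Finset.sum_congr rfl fun s _ => ?_
              split_ifs <;> ring
        _ ≤ Λ ^ n * (Λ * u h w) := mul_le_mul_of_nonneg_left (hloc h w hh hg) (pow_nonneg hΛ n)
        _ = Λ ^ (n + 1) * u h w := by ring
    · rintro ⟨st, v⟩ _ ⟨st', v'⟩ _ hp
      simp only [List.cons.injEq] at hp
      exact Prod.ext hp.1 hp.2

/-! ### The bridge: half-plane self-avoiding words are admissible for every memory -/

/-- `traj (s :: v) (i+1) = vec s + traj v i`. [folklore] -/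
private theorem traj_cons_succ (s : Step) (v : List Step) (i : ℕ) :
    traj (s :: v) (i + 1) = Step.vec s + traj v i := by
  simp only [traj, List.take_succ_cons, wEnd_cons]

/-- The window sum of the reversed last `k` letters of `p` is the displacement over those letters:
`wsum ((p.reverse).take k) = wEnd p − traj p (|p| − k)`. [folklore] -/
private theorem wsum_take_reverse (p : List Step) (k : ℕ) :
    wsum ((p.reverse).take k) = wEnd p - traj p (p.length - k) := by
  unfold wsum
  rw [List.take_reverse, List.map_reverse, List.sum_reverse, List.map_drop]
  have hsplit := List.sum_take_add_sum_drop (p.map Step.vec) (p.length - k)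
  have htraj : traj p (p.length - k) = ((p.map Step.vec).take (p.length - k)).sum := by
    simp [traj, wEnd, List.map_take]
  rw [htraj, wEnd]
  exact eq_sub_of_add_eq' hsplit

/-- **Every half-plane self-avoiding word is admissible, for every memory `m`**: from height `h` and window `w` with
`w = (p.reverse).take m` for the letters `p` already read, a word `v` with non-negative heights and `p ++ v`
self-avoiding is `Adm m h w v` — a zero-sum window of length `2j` means `traj i = traj (i+2j)`.
[cite: BeatonGuttmannJensen2012Adsorption, §1 (p. 2)] -/
theorem adm_of_saw (m : ℕ) : ∀ (v : List Step) (h : ℤ) (p : List Step),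
    (∀ i ≤ v.length, 0 ≤ h + traj v i 0) → IsSAW (p ++ v) → Adm m h ((p.reverse).take m) v
  | [], _, _, _, _ => trivial
  | s :: v, h, p, hh, hsaw => by
    have hal : Allowed m h ((p.reverse).take m) s := by
      refine ⟨?_, ?_⟩
      · intro hs2
        subst hs2
        have := hh 1 (by simp)
        rw [traj_cons_succ, traj_zero, add_zero] at this
        have hv : (Step.vec 2) 0 = -1 := by simp [Step.dx]
        rw [hv] at this
        omega
      · -- the new window is a prefix of ((p ++ [s]).reverse); a zero-sum even prefix closes a sub-walk of p ++ [s]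
        rintro ⟨j, hj, hj0, hs0⟩
        simp only [Finset.mem_range] at hj
        set q := p ++ [s] with hq
        have hwin : (s :: (p.reverse).take m).take (m + 1) = (q.reverse).take (m + 1) := by
          simp [hq, List.reverse_append]
        rw [hwin, List.take_take] at hs0
        have hql : q.length = p.length + 1 := by simp [hq]
        have hl : ((s :: List.take m p.reverse).take (m + 1)).length = min (m + 1) (p.length + 1) := by simp
        have h2j : 2 * j ≤ q.length := by omega
        have hmin : min (2 * j) (m + 1) = 2 * j := by omega
        rw [hmin, wsum_take_reverse q (2 * j)] at hs0
        -- so traj q (|q| - 2j) = traj q |q| : contradiction with self-avoidance of q (a prefix of p ++ s :: v)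
        have hsawq : IsSAW q := by
          have e : p ++ s :: v = q ++ v := by simp [hq]
          have : q = (q ++ v).take q.length := by simp
          rw [this, ← e]; exact hsaw.take _
        have hinj := (isSAW_iff_injOn _).1 hsawq
        have heq : traj q (q.length - 2 * j) = traj q q.length := by
          rw [traj_length]; exact (sub_eq_zero.1 hs0).symm
        have := hinj (by simp) (by simp) heq
        omega
    refine ⟨hal, ?_⟩
    have hnext : push m ((p.reverse).take m) s = ((p ++ [s]).reverse).take m := by
      cases m with
      | zero => simp [push]
      | succ k => simp [push, List.reverse_append, List.take_take]
    rw [hnext]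
    refine adm_of_saw m v (h + s.dx) (p ++ [s]) (fun i hi => ?_) (by simpa using hsaw)
    have := hh (i + 1) (by simpa using hi)
    rwa [traj_cons_succ, Pi.add_apply, Step.vec_apply_zero, ← add_assoc] at this

/-! ### `val` and the wall visits; the bound on `Z⁺_n(a)` -/

/-- First-letter recursion for `LowTemp.zc`. [folklore] -/
private theorem zc_cons' (h : ℤ) (s : Step) (v : List Step) :
    zc h (s :: v) = (if h + s.dx = 0 then 1 else 0) + zc (h + s.dx) v := by
  unfold zc
  rw [List.length_cons, Finset.sum_range_succ']
  simp only [traj_cons_succ, Pi.add_apply, Step.vec_apply_zero, traj_zero, Pi.zero_apply, add_zero, ← add_assoc]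
  exact add_comm _ _

/-- `val ≥ δ · a^{#wall times}` along admissible words from good windows. [folklore] -/
private theorem val_ge {m : ℕ} : ∀ (v : List Step) (h : ℤ) (w : List Step) {u : ℤ → List Step → ℝ} {a δ : ℝ},
    0 ≤ a → (∀ h w, 0 ≤ h → Good m w → δ ≤ u h w) → 0 ≤ h → Good m w → Adm m h w v →
    δ * a ^ zc h v ≤ val m u a h w v
  | [], h, w, u, a, δ, _, hu, hh, hg, _ => by simpa [val, zc] using hu h w hh hg
  | s :: v, h, w, u, a, δ, ha, hu, hh, hg, hadm => by
    obtain ⟨hal, hadm'⟩ := hadm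
    rw [val, zc_cons', pow_add]
    have hh' : 0 ≤ h + s.dx := by
      rcases hal with ⟨hs2, -⟩
      fin_cases s <;> simp [Step.dx] at hs2 ⊢ <;> omega
    have ih := val_ge v (h + s.dx) (push m w s) ha hu hh' (good_push hg hal) hadm'
    have hwt : wt a (h + s.dx) = a ^ (if h + s.dx = 0 then 1 else 0) := by
      unfold wt; split_ifs <;> simp
    rw [hwt]
    calc δ * (a ^ (if h + s.dx = 0 then 1 else 0) * a ^ zc (h + s.dx) v)
        = a ^ (if h + s.dx = 0 then 1 else 0) * (δ * a ^ zc (h + s.dx) v) := by ring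
      _ ≤ a ^ (if h + s.dx = 0 then 1 else 0) * val m u a (h + s.dx) (push m w s) v :=
        mul_le_mul_of_nonneg_left ih (pow_nonneg ha _)

/-- `zc 0 v = wallVisits |v| (traj v)`. [folklore] -/
private theorem zc_zero_eq_wallVisits' {n : ℕ} {v : List Step} (hl : v.length = n) :
    zc 0 v = wallVisits n (traj v) := by
  classical
  unfold zc wallVisits
  rw [Finset.card_filter, Finset.sum_range_succ', hl]
  simp

/-- The empty window is good. [cite: BeatonGuttmannJensen2012Adsorption, §1 (p. 2)] -/
theorem good_nil (m : ℕ) : Good m [] :=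
  ⟨by simp, fun k => by simpa using not_bad_nil⟩

/-- **`Z⁺_n(a) ≤ Λⁿ · u(0, []) / δ`** for every memory `m` and every potential `u ≥ δ > 0` (on good windows, `h ≥ 0`) that is
`Λ`-excessive for the zero-sum-window rule. [cite: BeatonGuttmannJensen2012Adsorption, §1 (p. 2)] -/
theorem adsZ_le_of_potential (m : ℕ) (u : ℤ → List Step → ℝ) {a Λ δ : ℝ} (ha : 0 ≤ a) (hΛ : 0 ≤ Λ) (hδ : 0 < δ)
    (hu : ∀ h w, 0 ≤ h → Good m w → δ ≤ u h w) (hu0 : ∀ h w, 0 ≤ u h w)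
    (hloc : ∀ h w, 0 ≤ h → Good m w → locSum m u a h w ≤ Λ * u h w) (n : ℕ) :
    adsZ n a ≤ Λ ^ n * u 0 [] / δ := by
  classical
  set good : Finset (List Step) := (sawWords n).filter (fun v => ∀ i ≤ n, 0 ≤ traj v i 0) with hgood
  have himage : hpWalks n = good.image traj := by
    ext ω
    simp only [mem_hpWalks, Finset.mem_image, hgood, Finset.mem_filter, mem_sawWords]
    constructor
    · rintro ⟨hω, hhp⟩
      have hω' : ω ∈ (sawWords n).image traj := by rw [image_traj_sawWords]; exact hω
      obtain ⟨v, hv, rfl⟩ := Finset.mem_image.1 hω'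
      exact ⟨v, ⟨mem_sawWords.1 hv, hhp⟩, rfl⟩
    · rintro ⟨v, ⟨⟨hl, hs⟩, hhp⟩, rfl⟩
      exact ⟨traj_mem_saws hl hs, hhp⟩
  have hmem : ∀ v ∈ good, (v.length = n ∧ IsSAW v) ∧ ∀ i ≤ n, 0 ≤ traj v i 0 := fun v hv => by
    simpa [hgood] using hv
  have hinj : Set.InjOn traj (good : Set (List Step)) := fun v hv v' hv' h =>
    traj_injOn n (by simp [(hmem v hv).1.1]) (by simp [(hmem v' hv').1.1]) h
  rw [adsZ, himage, Finset.sum_image hinj]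
  have hterm : ∀ v ∈ good, a ^ wallVisits n (traj v) ≤ F m u a 0 [] v / δ := by
    intro v hv
    obtain ⟨⟨hl, hs⟩, hhp⟩ := hmem v hv
    have hadm : Adm m 0 [] v := by
      have := adm_of_saw m v 0 [] (by simpa [hl] using hhp) (by simpa using hs)
      simpa using this
    rw [F, if_pos hadm, ← zc_zero_eq_wallVisits' hl, le_div_iff₀ hδ, mul_comm]
    exact val_ge v 0 [] ha hu le_rfl (good_nil m) hadm
  have hsub : good ⊆ words n := fun v hv => mem_words.2 (hmem v hv).1.1
  calc ∑ v ∈ good, a ^ wallVisits n (traj v) ≤ ∑ v ∈ good, F m u a 0 [] v / δ := Finset.sum_le_sum hterm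
    _ ≤ ∑ v ∈ words n, F m u a 0 [] v / δ :=
        Finset.sum_le_sum_of_subset_of_nonneg hsub fun v _ _ => div_nonneg (F_nonneg hu0 ha _ _ _) hδ.le
    _ = (∑ v ∈ words n, F m u a 0 [] v) / δ := by rw [Finset.sum_div]
    _ ≤ Λ ^ n * u 0 [] / δ := by
        gcongr
        exact sum_words_le ha hΛ hloc n 0 [] le_rfl (good_nil m)

end LowTempWin

end Literature.Probability.RandomPlanarGeometry.SAW.Zd

end
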